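/-
Copyright (c) 2026. All rights reserved.
Released under Apache 2.0 license as described in the file LICENSE.
-/
import Summits.AtomisticToContinuum.Crystallization.Theorems.OverbindingBudgetAffineFarStraighteningTwoStep
import Summits.AtomisticToContinuum.Crystallization.Theorems.OverbindingBudgetAffineFarStraighteningConformal

/-! # RAFF — `AffineChartStraightening'` from an integer-exact radial development (assembly PROVED; the development is the one remaining input)

Route `decomp-a2c` (lens 4, g59), slot `Z` of `FarAggregatePricing`, leaf `R_aff′ = AffineChartStraightening'` (θ ≤ 1/25).  Memo
`NODE-g59-RaffDesign.md` §3 splits `R_aff′` into a DEVELOPMENT and an ASSEMBLY.  The development output is the `Prop`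
`RaffDevelopment K` below — DELIBERATELY MINIMAL: a frame `A ≈ Q` at `i`; developed positions `x̂` with
`|y m − (y i + nn_i • A (x̂ m))| ≤ K ρ² ε₁ nn_i` on the closed `ρ`-ball; and on the `(ρ − 7/4)`-ball, per site `j`, a two-shell pattern
`Pat j`, an isometry `R j` and a labelled neighbour map `σ j` with INTEGER-EXACTNESS `x̂ (σ j v) = x̂ j + R j v` for all 18 pattern vectors
and EXHAUSTIVE LABELLING of the physical `3/2·nn_j`-ball.  No snaps, no comparability, no `nn_i > 0` are assumed: this file DERIVES them
(`nn_j ∈ [0.93, 1.07]·nn_i`; for an inner `j` and a first-shell `v` the frames of `j` and `m = σ j v` differ by the exact snap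
`U = R_j⁻¹ ∘ R_m`, `IsSnap (Pat j) (Pat m) v f U`, read off from integer-exactness at `j` and `m` and exhaustive labelling) and PROVES

* `affineChartStraightening'_of_development : 0 ≤ K → RaffDevelopment K → AffineChartStraightening'`,

including the local-exactness step (clause (e) of `R_aff′`): a developed `k` with `‖z k − z j‖ ≤ 3/2·a₀` has `x̂ k − x̂ j = R j p` for some
`p ∈ Pat j`.  Proof of (e): `‖x̂ k − x̂ j‖ ≤ (3/2)/(1 − √6/2·θ) < √(8/3)`; a first-shell `v ∈ Pat j` within `45°` of `R_j⁻¹(x̂ k − x̂ j)`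
(`exists_deep_of_twoShell`) names `m = σ j v`; `k` lies within `3/2·nn_m` of `y m`, so `k = σ m u'`; the snap `R m = R j ∘ U` and the
TWO-STEP closure `snapTwoStep_holds` (`dist u' f² = ‖x̂ k − x̂ j‖² < 8/3`) put `v + U u'` in `insert 0 (Pat j)`, and `0` is excluded by
`nn_j > 2δ`.  Constants: `C := K`, `a₀ := nn_i`, `B := A_i`, `Q₀ := Q_i`, `z := y_i + nn_i • A_i x̂` on the `ρ`-ball, `z := y` outside.
-/

namespace Summit.AtomisticToContinuum.Crystallization.Theorems.OverbindingBudgetAffineFarSmoothSplit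

open scoped BigOperators RealInnerProductSpace
open Literature.Geometry.DiscreteGeometry (nearestDist nearestDist_nonneg nearestDist_le_dist exists_nearestDist_eq_dist
  fccTwoShellPattern hcpTwoShellPattern norm_of_mem_fccTwoShellPattern norm_of_mem_hcpTwoShellPattern)
open Summit.AtomisticToContinuum.Crystallization.Theorems.OverbindingBudgetAffineLadder (AffDeepReg)

/-! ## §1  The development output -/

/-- **DEV output (integer-exact radial development), constant `K`.**  Around an affinely `ρ`-deeply registered site `i`
(`θ ≤ 1/25`, `K ρ² ε₁ ≤ 1/100`): a frame `A ≈ Q` at `i` with the operator bound `√6/2·θ`; developed positions `x̂` with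
`|y m − (y i + nn_i • A (x̂ m))| ≤ K ρ² ε₁ nn_i` on the closed ball `ρ·nn_i`; on the ball `(ρ − 7/4)·nn_i` each site `j` carries a
two-shell pattern `Pat j`, a linear isometry `R j` and a labelled neighbour map `σ j` which is INTEGER-EXACT — `x̂ (σ j v) = x̂ j + R j v`
for every `v ∈ Pat j`, with `σ j v` in the `ρ`-ball — and EXHAUSTIVE — every site `≠ j` within `3/2·nn_j` of `y j` is some `σ j v`.
[g59 memo NODE-g59-RaffDesign §3 R4] -/
def RaffDevelopment (K : ℝ) : Prop :=
  ∀ (ρ ε₁ θ : ℝ), 4 ≤ ρ → 0 < ε₁ → 0 ≤ θ → θ ≤ 1 / 25 → K * ρ ^ 2 * ε₁ ≤ 1 / 100 →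
    ∀ (N : ℕ) (y : Fin N → EuclideanSpace ℝ (Fin 3)) (i : Fin N), Function.Injective y → AffDeepReg ρ ε₁ θ (1 / 450) y i →
      ∃ (A : EuclideanSpace ℝ (Fin 3) →ₗ[ℝ] EuclideanSpace ℝ (Fin 3)) (Q : EuclideanSpace ℝ (Fin 3) →ₗᵢ[ℝ] EuclideanSpace ℝ (Fin 3))
        (x : Fin N → EuclideanSpace ℝ (Fin 3)) (R : Fin N → (EuclideanSpace ℝ (Fin 3) →ₗᵢ[ℝ] EuclideanSpace ℝ (Fin 3)))
        (Pat : Fin N → Finset (EuclideanSpace ℝ (Fin 3))) (σ : Fin N → EuclideanSpace ℝ (Fin 3) → Fin N),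
        (∀ v, ‖A v - Q v‖ ≤ Real.sqrt 6 / 2 * θ * ‖v‖) ∧
        (∀ m, dist (y m) (y i) ≤ ρ * nearestDist y i →
          dist (y m) (y i + nearestDist y i • A (x m)) ≤ K * ρ ^ 2 * ε₁ * nearestDist y i) ∧
        (∀ j, dist (y j) (y i) ≤ (ρ - 7 / 4) * nearestDist y i →
          (Pat j = fccTwoShellPattern ∨ Pat j = hcpTwoShellPattern) ∧
          (∀ v ∈ Pat j, dist (y (σ j v)) (y i) ≤ ρ * nearestDist y i ∧ x (σ j v) = x j + R j v) ∧
          (∀ k, k ≠ j → dist (y k) (y j) ≤ 3 / 2 * nearestDist y j → ∃ v ∈ Pat j, σ j v = k))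

/-! ## §2  The assembly -/

/-- Elementary step of the local-exactness argument: `0 ≤ t ≤ 1.578`, `t ≤ √2·ip` and `s² = t² − 2·ip + 1` give `s ≤ 1.141`.
[this file] -/
theorem raff_dist_aux {t ip s : ℝ} (ht0 : 0 ≤ t) (ht : t ≤ 1578 / 1000) (hcov : t ≤ Real.sqrt 2 * ip)
    (hs : s ^ 2 = t ^ 2 - 2 * ip + 1) (hs0 : 0 ≤ s) : s ≤ 1141 / 1000 := by
  have hs2 : (1414 : ℝ) / 1000 < Real.sqrt 2 := by
    rw [Real.lt_sqrt (by norm_num)]; norm_num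
  have h22 : Real.sqrt 2 * (Real.sqrt 2 * ip) = 2 * ip := by rw [← mul_assoc, Real.mul_self_sqrt zero_le_two]
  have hip : 0 ≤ ip := by
    by_contra hneg
    push Not at hneg
    nlinarith [mul_neg_of_pos_of_neg (Real.sqrt_pos.2 (two_pos : (0 : ℝ) < 2)) hneg]
  have h3 : 1414 / 1000 * t ≤ 2 * ip := by
    nlinarith [mul_le_mul_of_nonneg_left hcov (Real.sqrt_nonneg 2), mul_le_mul_of_nonneg_right hs2.le ht0]
  have h5 : s ^ 2 ≤ 13 / 10 := by nlinarith [mul_nonneg ht0 (sub_nonneg.2 ht)]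
  exact (pow_le_pow_iff_left₀ hs0 (by norm_num) two_ne_zero).1 (h5.trans (by norm_num))

/-- **RAFF · assembly.**  An integer-exact radial development yields `AffineChartStraightening'` (with `C := K`).
[g59 memo NODE-g59-RaffDesign §3 R5] -/
theorem affineChartStraightening'_of_development {K : ℝ} (hK : 0 ≤ K) (hdev : RaffDevelopment K) :
    AffineChartStraightening' := by
  classical
  refine ⟨K, hK, ?_⟩
  intro ρ ε₁ θ hρ hε₁ hθ0 hθ hKε N y i hy hdeep
  obtain ⟨A, Q, x, R, Pat, σ, hAQ, hpos, hstr⟩ := hdev ρ ε₁ θ hρ hε₁ hθ0 hθ hKε N y i hy hdeep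
  set nn := nearestDist y i with hnn_def
  have hnn0 : 0 ≤ nn := nearestDist_nonneg _ _
  -- operator bounds for the frame at `i`
  have hc : Real.sqrt 6 / 2 * θ ≤ 49 / 1000 := by
    have h6 : Real.sqrt 6 < 49 / 20 := by
      rw [Real.sqrt_lt' (by norm_num)]; norm_num
    nlinarith [Real.sqrt_nonneg 6]
  have hAup : ∀ w, ‖A w‖ ≤ 1049 / 1000 * ‖w‖ := fun w => by
    have h1 := hAQ w
    have h2 : ‖A w‖ ≤ ‖Q w‖ + ‖A w - Q w‖ := by
      calc ‖A w‖ = ‖Q w + (A w - Q w)‖ := by rw [add_sub_cancel]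
        _ ≤ ‖Q w‖ + ‖A w - Q w‖ := norm_add_le _ _
    rw [Q.norm_map] at h2
    nlinarith [norm_nonneg w]
  have hAlo : ∀ w, 951 / 1000 * ‖w‖ ≤ ‖A w‖ := fun w => by
    have h1 := hAQ w
    have h2 : ‖Q w‖ ≤ ‖A w‖ + ‖A w - Q w‖ := by
      calc ‖Q w‖ = ‖A w - (A w - Q w)‖ := by rw [sub_sub_cancel]
        _ ≤ ‖A w‖ + ‖A w - Q w‖ := norm_sub_le _ _
    rw [Q.norm_map] at h2
    nlinarith [norm_nonneg w]
  -- pattern vectors have norm `≥ 1`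
  have hone : ∀ {P : Finset (EuclideanSpace ℝ (Fin 3))}, (P = fccTwoShellPattern ∨ P = hcpTwoShellPattern) →
      ∀ v ∈ P, 1 ≤ ‖v‖ := by
    have h1 : (1 : ℝ) ≤ Real.sqrt 2 := Real.one_le_sqrt.mpr (by norm_num)
    rintro P (rfl | rfl) v hv
    · rcases norm_of_mem_fccTwoShellPattern hv with h | h <;> rw [h]
      exact h1
    · rcases norm_of_mem_hcpTwoShellPattern hv with h | h <;> rw [h]
      exact h1
  -- a labelled neighbour is a different site
  have hσne : ∀ j, dist (y j) (y i) ≤ (ρ - 7 / 4) * nn → ∀ v ∈ Pat j, σ j v ≠ j := by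
    intro j hj v hv h
    obtain ⟨hPj, hI1j, -⟩ := hstr j hj
    have h2 := (hI1j v hv).2
    rw [h] at h2
    have h3 : R j v = 0 := by
      have h4 : x j + R j v = x j + 0 := by rw [add_zero]; exact h2.symm
      exact add_left_cancel h4
    have h5 : ‖v‖ = 0 := by rw [← (R j).norm_map, h3, norm_zero]
    linarith only [h5, hone hPj v hv]
  -- `i` itself is structured, hence has a neighbour, hence `nn_i > 0`
  have hi74 : dist (y i) (y i) ≤ (ρ - 7 / 4) * nn := by
    rw [dist_self]; exact mul_nonneg (by linarith) hnn0
  obtain ⟨hPi, -, -⟩ := hstr i hi74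
  obtain ⟨v₀, hv₀, -, -⟩ := exists_deep_of_twoShell hPi 0
  have hnn : 0 < nn := by
    obtain ⟨k₁, hk₁, hk₁d⟩ := exists_nearestDist_eq_dist y ⟨σ i v₀, hσne i hi74 v₀ hv₀⟩
    rw [hnn_def, hk₁d]
    exact dist_pos.2 fun h => hk₁ (hy h).symm
  set δ := K * ρ ^ 2 * ε₁ * nn with hδ_def
  have hδnn : δ ≤ nn / 100 := by
    have : δ = K * ρ ^ 2 * ε₁ * nn := rfl
    linarith only [this, mul_le_mul_of_nonneg_right hKε hnn.le]
  have hδ0 : 0 ≤ δ := by positivity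
  -- two-point sandwich on the `ρ`-ball
  have hsand : ∀ m m', dist (y m) (y i) ≤ ρ * nn → dist (y m') (y i) ≤ ρ * nn →
      dist (y m) (y m') ≤ nn * ‖A (x m - x m')‖ + 2 * δ ∧ nn * ‖A (x m - x m')‖ ≤ dist (y m) (y m') + 2 * δ := by
    intro m m' hm hm'
    have h1 := hpos m hm
    have h2 := hpos m' hm'
    have hpp : dist (y i + nn • A (x m)) (y i + nn • A (x m')) = nn * ‖A (x m - x m')‖ := by
      rw [dist_eq_norm, add_sub_add_left_eq_sub, ← smul_sub, ← map_sub, norm_smul, Real.norm_of_nonneg hnn.le]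
    constructor
    · calc dist (y m) (y m') ≤ dist (y m) (y i + nn • A (x m)) + dist (y i + nn • A (x m)) (y i + nn • A (x m')) +
            dist (y i + nn • A (x m')) (y m') := dist_triangle4 _ _ _ _
        _ ≤ δ + nn * ‖A (x m - x m')‖ + δ := by rw [hpp, dist_comm (y i + nn • A (x m'))]; gcongr
        _ = _ := by ring
    · calc nn * ‖A (x m - x m')‖ = dist (y i + nn • A (x m)) (y i + nn • A (x m')) := hpp.symm
        _ ≤ dist (y i + nn • A (x m)) (y m) + dist (y m) (y m') + dist (y m') (y i + nn • A (x m')) := dist_triangle4 _ _ _ _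
        _ ≤ δ + dist (y m) (y m') + δ := by rw [dist_comm (y i + nn • A (x m))]; gcongr
        _ = _ := by ring
  -- comparability of spacings on the structured ball
  have hcomp : ∀ j, dist (y j) (y i) ≤ (ρ - 7 / 4) * nn → 93 / 100 * nn ≤ nearestDist y j ∧ nearestDist y j ≤ 107 / 100 * nn := by
    intro j hj
    have hjρ : dist (y j) (y i) ≤ ρ * nn := hj.trans (mul_le_mul_of_nonneg_right (by linarith) hnn.le)
    obtain ⟨hPj, hI1j, hexj⟩ := hstr j hj
    obtain ⟨v₁, hv₁, hv₁1, -⟩ := exists_deep_of_twoShell hPj 0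
    obtain ⟨hmρ, hxm⟩ := hI1j v₁ hv₁
    have hmj : σ j v₁ ≠ j := hσne j hj v₁ hv₁
    have hup : nearestDist y j ≤ 107 / 100 * nn := by
      have h1 := nearestDist_le_dist y hmj
      have h2 := (hsand (σ j v₁) j hmρ hjρ).1
      rw [hxm, add_sub_cancel_left] at h2
      have h3 : ‖A (R j v₁)‖ ≤ 1049 / 1000 := by
        have := hAup (R j v₁); rwa [(R j).norm_map, hv₁1, mul_one] at this
      rw [dist_comm] at h1
      linarith only [h1, h2, mul_le_mul_of_nonneg_left h3 hnn.le, hδnn, hnn]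
    refine ⟨?_, hup⟩
    obtain ⟨k₁, hk₁j, hk₁d⟩ := exists_nearestDist_eq_dist y ⟨σ j v₁, hmj⟩
    have hk₁env : dist (y k₁) (y j) ≤ 3 / 2 * nearestDist y j := by
      rw [dist_comm, ← hk₁d]; linarith [nearestDist_nonneg y j]
    obtain ⟨w, hw, hσw⟩ := hexj k₁ hk₁j hk₁env
    obtain ⟨hk₁ρ, hxk₁⟩ := hI1j w hw
    rw [hσw] at hk₁ρ hxk₁
    have h2 := (hsand k₁ j hk₁ρ hjρ).2
    rw [hxk₁, add_sub_cancel_left, dist_comm, ← hk₁d] at h2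
    have h3 : 951 / 1000 ≤ ‖A (R j w)‖ := by
      have := hAlo (R j w); rw [(R j).norm_map] at this; linarith only [this, hone hPj w hw]
    linarith only [h2, mul_le_mul_of_nonneg_left h3 hnn.le, hδnn, hnn]
  -- the straightened configuration: developed sites are moved onto the development, the rest stay
  obtain ⟨z, hzD, hzD'⟩ : ∃ z : Fin N → EuclideanSpace ℝ (Fin 3),
      (∀ m, dist (y m) (y i) ≤ ρ * nn → z m = y i + nn • A (x m)) ∧ (∀ m, ¬ dist (y m) (y i) ≤ ρ * nn → z m = y m) :=
    ⟨fun m => if dist (y m) (y i) ≤ ρ * nn then y i + nn • A (x m) else y m, fun m hm => if_pos hm, fun m hm => if_neg hm⟩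
  refine ⟨nn, A, Q, z, ?_, ?_, ?_, ?_⟩
  · rw [sub_self, abs_zero]; positivity
  · intro v
    refine (hAQ v).trans (mul_le_mul_of_nonneg_right ?_ (norm_nonneg _))
    linarith only [sqrt_six_div_two_mul_le hθ0, mul_nonneg hK hε₁.le]
  · intro j
    by_cases hj : dist (y j) (y i) ≤ ρ * nn
    · rw [hzD j hj, dist_comm]; exact hpos j hj
    · rw [hzD' j hj, dist_self]; positivity
  · intro j hjin
    have hjD : dist (y j) (y i) ≤ ρ * nn := hjin.trans (mul_le_mul_of_nonneg_right (by linarith) hnn.le)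
    have hj74 : dist (y j) (y i) ≤ (ρ - 7 / 4) * nn := hjin.trans (mul_le_mul_of_nonneg_right (by linarith) hnn.le)
    obtain ⟨hPj, hI1j, hexj⟩ := hstr j hj74
    obtain ⟨hnnj_lo, hnnj_hi⟩ := hcomp j hj74
    refine ⟨R j, Pat j, hPj, ?_, ?_⟩
    · intro v hv
      obtain ⟨hkD, hxk⟩ := hI1j v hv
      refine ⟨σ j v, ?_⟩
      rw [hzD _ hkD, hzD j hjD, hxk, map_add, smul_add, add_assoc]
    · intro k hkj hdist
      -- `k` is developed
      have hkD : dist (y k) (y i) ≤ ρ * nn := by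
        by_contra hkD
        have hzk := hzD' k hkD
        have h1 : dist (y k) (y j) ≤ 3 / 2 * nn + δ := by
          calc dist (y k) (y j) ≤ dist (y k) (z j) + dist (z j) (y j) := dist_triangle _ _ _
            _ ≤ 3 / 2 * nn + δ := by
                refine add_le_add ?_ ?_
                · rw [← hzk]; exact hdist
                · rw [hzD j hjD, dist_comm]; exact hpos j hjD
        have h2 : dist (y k) (y i) ≤ ρ * nn := by
          calc dist (y k) (y i) ≤ dist (y k) (y j) + dist (y j) (y i) := dist_triangle _ _ _
            _ ≤ (3 / 2 * nn + δ) + (ρ - 3) * nn := add_le_add h1 hjin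
            _ ≤ ρ * nn := by linarith only [hδnn, hnn]
        exact hkD h2
      have hzdiff : z k - z j = nn • A (x k - x j) := by
        rw [hzD k hkD, hzD j hjD, map_sub, smul_sub]; abel
      -- reduce to a statement about `x̂ k − x̂ j`
      suffices hmain : ∃ p ∈ Pat j, x k - x j = R j p by
        obtain ⟨p, hp, hwp⟩ := hmain
        exact ⟨p, hp, by rw [← sub_eq_iff_eq_add', hzdiff, hwp]⟩
      have hAw : ‖A (x k - x j)‖ ≤ 3 / 2 := by
        have h1 : ‖nn • A (x k - x j)‖ ≤ 3 / 2 * nn := by rw [← hzdiff, ← dist_eq_norm]; exact hdist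
        rw [norm_smul, Real.norm_of_nonneg hnn.le] at h1
        nlinarith only [h1, hnn]
      have hwn : ‖x k - x j‖ ≤ 1578 / 1000 := by
        have := hAlo (x k - x j); linarith only [this, hAw]
      have hw83 : ‖x k - x j‖ ^ 2 < 8 / 3 := by nlinarith only [hwn, norm_nonneg (x k - x j)]
      -- 45° covering in pattern coordinates: a first-shell `v ∈ Pat j` with `‖w‖ ≤ √2 ⟪w, R j v⟫`
      let Ej : EuclideanSpace ℝ (Fin 3) ≃ₗᵢ[ℝ] EuclideanSpace ℝ (Fin 3) := (R j).toLinearIsometryEquiv rfl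
      have hEj : ∀ w, Ej w = R j w := fun w => rfl
      obtain ⟨v, hv, hv1, hcov⟩ := exists_deep_of_twoShell hPj (Ej.symm (x k - x j))
      have hcov' : ‖x k - x j‖ ≤ Real.sqrt 2 * ⟪x k - x j, R j v⟫ := by
        have h1 : ⟪Ej.symm (x k - x j), v⟫ = ⟪x k - x j, R j v⟫ := by
          rw [← Ej.inner_map_map, LinearIsometryEquiv.apply_symm_apply, hEj]
        rw [← h1, ← Ej.symm.norm_map (x k - x j)]
        exact hcov
      -- the intermediate developed neighbour `m = σ j v`: structured, labelled back, exactly snapped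
      obtain ⟨hmD, hxm⟩ := hI1j v hv
      have hmj : σ j v ≠ j := hσne j hj74 v hv
      have hARv : ‖A (R j v)‖ ≤ 1049 / 1000 := by
        have := hAup (R j v); rwa [(R j).norm_map, hv1, mul_one] at this
      have hdmj : dist (y (σ j v)) (y j) ≤ 107 / 100 * nn := by
        have h2 := (hsand (σ j v) j hmD hjD).1
        rw [hxm, add_sub_cancel_left] at h2
        linarith only [h2, mul_le_mul_of_nonneg_left hARv hnn.le, hδnn, hnn]
      have hm74 : dist (y (σ j v)) (y i) ≤ (ρ - 7 / 4) * nn := by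
        calc dist (y (σ j v)) (y i) ≤ dist (y (σ j v)) (y j) + dist (y j) (y i) := dist_triangle _ _ _
          _ ≤ 107 / 100 * nn + (ρ - 3) * nn := add_le_add hdmj hjin
          _ ≤ (ρ - 7 / 4) * nn := by linarith only [hnn]
      obtain ⟨hPm, hI1m, hexm⟩ := hstr (σ j v) hm74
      obtain ⟨hnnm_lo, hnnm_hi⟩ := hcomp (σ j v) hm74
      -- the back label `f` of `j` at `m`
      obtain ⟨f, hf, hσf⟩ := hexm j hmj.symm (by rw [dist_comm]; linarith only [hdmj, hnnm_lo, hnn])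
      have hRmf : R (σ j v) f = -(R j v) := by
        have h2 := (hI1m f hf).2
        rw [hσf, hxm] at h2
        have h3 : x j + (R j v + R (σ j v) f) = x j + 0 := by rw [add_zero, ← add_assoc]; exact h2.symm
        exact eq_neg_of_add_eq_zero_right (add_left_cancel h3)
      -- the snap `U = R_j⁻¹ ∘ R_m`
      let U : EuclideanSpace ℝ (Fin 3) →ₗᵢ[ℝ] EuclideanSpace ℝ (Fin 3) := Ej.symm.toLinearIsometry.comp (R (σ j v))
      have hRU : ∀ w, R (σ j v) w = R j (U w) := fun w => by
        show R (σ j v) w = Ej (Ej.symm (R (σ j v) w))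
        rw [LinearIsometryEquiv.apply_symm_apply]
      have hUf : U f = -v := (R j).injective (by rw [← hRU, hRmf, map_neg])
      have hU : IsSnap (Pat j) (Pat (σ j v)) v f U.toLinearMap := by
        refine ⟨by rw [LinearIsometry.coe_toLinearMap]; exact hUf, fun c' hc' => ?_⟩
        rw [LinearIsometry.coe_toLinearMap]
        obtain ⟨hc'P, hc'1, hc'f⟩ := hc'
        -- the site `n = σ m c'` is a common neighbour of `m` and `j`
        obtain ⟨hnD, hxn⟩ := hI1m c' hc'P
        have hxnj : x (σ (σ j v) c') - x j = R (σ j v) (c' - f) := by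
          rw [hxn, hxm, map_sub, hRmf]; abel
        have hn1 : ‖x (σ (σ j v) c') - x j‖ = 1 := by rw [hxnj, (R (σ j v)).norm_map, hc'f]
        have hnj : σ (σ j v) c' ≠ j := by
          intro h; rw [h, sub_self, norm_zero] at hn1; exact zero_ne_one hn1
        have hdnj : dist (y (σ (σ j v) c')) (y j) ≤ 3 / 2 * nearestDist y j := by
          have h2 := (hsand (σ (σ j v) c') j hnD hjD).1
          have h3 : ‖A (x (σ (σ j v) c') - x j)‖ ≤ 1049 / 1000 := by
            have := hAup (x (σ (σ j v) c') - x j); rwa [hn1, mul_one] at this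
          linarith only [h2, mul_le_mul_of_nonneg_left h3 hnn.le, hδnn, hnnj_lo, hnn]
        obtain ⟨w, hw, hσw⟩ := hexj _ hnj hdnj
        obtain ⟨-, hxw⟩ := hI1j w hw
        rw [hσw] at hxw
        have hRjw : R j w = R (σ j v) (c' - f) := by rw [← hxnj, hxw, add_sub_cancel_left]
        have hwU : w = U c' + v := by
          apply (R j).injective
          rw [hRjw, map_add, ← hRU, map_sub, hRmf, sub_neg_eq_add]
        refine ⟨hwU ▸ hw, ?_, ?_⟩
        · rw [← hwU, ← (R j).norm_map, hRjw, (R (σ j v)).norm_map, hc'f]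
        · rw [add_sub_cancel_right, U.norm_map, hc'1]
      by_cases hkm : k = σ j v
      · exact ⟨v, hv, by rw [hkm, hxm, add_sub_cancel_left]⟩
      -- `k` lies in the labelled ball of `m`
      have hdkm : dist (y k) (y (σ j v)) ≤ 3 / 2 * nearestDist y (σ j v) := by
        have hxkm : x k - x (σ j v) = (x k - x j) - R j v := by rw [hxm]; abel
        have h1 := (hsand k (σ j v) hkD hmD).1
        rw [hxkm] at h1
        have h2' : ‖(x k - x j) - R j v‖ ≤ 1141 / 1000 := by
          have hns := norm_sub_sq_real (x k - x j) (R j v)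
          rw [(R j).norm_map, hv1, one_pow] at hns
          exact raff_dist_aux (norm_nonneg _) hwn hcov' hns (norm_nonneg _)
        have h4 : nn * ‖A ((x k - x j) - R j v)‖ ≤ nn * (1049 / 1000 * (1141 / 1000)) :=
          mul_le_mul_of_nonneg_left ((hAup _).trans (mul_le_mul_of_nonneg_left h2' (by norm_num))) hnn.le
        linarith only [h1, h4, hδnn, hnnm_lo, hnn]
      obtain ⟨u', hu', hσu'⟩ := hexm k hkm hdkm
      obtain ⟨-, hxk'⟩ := hI1m u' hu'
      rw [hσu'] at hxk'
      have hwdec : x k - x j = R j (v + U u') := by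
        rw [hxk', hxm, hRU u', map_add]; abel
      -- TWO-STEP closure
      have hf1 : ‖f‖ = 1 := by rw [← U.norm_map, hUf, norm_neg, hv1]
      have hdist' : dist u' f ^ 2 < 8 / 3 := by
        have : dist u' f = ‖x k - x j‖ := by
          rw [dist_eq_norm, ← U.norm_map, map_sub, hUf, sub_neg_eq_add, add_comm, hwdec, (R j).norm_map]
        rw [this]; exact hw83
      have hmem := snapTwoStep_holds (Pat j) (Pat (σ j v)) hPj hPm v hv hv1 f hf hf1 U hU u' (Finset.mem_insert_of_mem hu')
        hdist'
      rcases Finset.mem_insert.1 hmem with h0 | hp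
      · -- `v + U u' = 0` would put `k` on top of `j`
        exfalso
        have hxkj : x k - x j = 0 := by rw [hwdec, h0, map_zero]
        have h2 : nearestDist y j ≤ dist (y j) (y k) := nearestDist_le_dist y hkj
        have h3 := (hsand k j hkD hjD).1
        rw [hxkj, map_zero, norm_zero, mul_zero, zero_add, dist_comm] at h3
        linarith only [h2, h3, hnnj_lo, hδnn, hnn]
      · exact ⟨v + U u', hp, hwdec⟩

end Summit.AtomisticToContinuum.Crystallization.Theorems.OverbindingBudgetAffineFarSmoothSplit
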